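import Summits.ResolutionOfSingularities.ResolutionOfSingularities.Theses.WeightedInvariant
import Summits.ResolutionOfSingularities.ResolutionOfSingularities.Theorems.WeightedInvariantWeightedConstructionStaticReduction
import Summits.ResolutionOfSingularities.ResolutionOfSingularities.Theorems.WeightedInvariantWeightedConstructionStaticLevers

/-!
# Crux `WeightedConstruction` (stmt-ResolutionOfSingularities-0571) — line `no-phi-rays-static-drop`, lead c3 skeleton

Route `ResolutionOfSingularities/WeightedInvariant`. The crux is
`WeightedConstruction := ∀ p prime, Nonempty (WeightedResolutionDatum p)`.

STATE OF THE LINE (lead c3, 2026-08-16T21:4xZ). Every infrastructure stub of the line has LANDED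
(lead c2): `cobordantExceptional`, `StaticPreDatum`, `stub_exceptional_point`
(Theorems/…StaticDefs.lean), `stub_exceptional_principal` (…ExceptionalPrincipal.lean),
`stub_exceptional_smooth` (…ExceptionalSmooth.lean), `stub_openPieces` (…CobordantPlusOpenPieces.lean),
`stub_initialIdeal` (…InitialIdeal.lean, Włodarczyk Lemma 4.1.7) and the line's reduction
`stub_staticReduction : Nonempty (StaticPreDatum p) → Nonempty (WeightedResolutionDatum p)`
(…StaticReduction.lean: `(R)` restriction + `(CI)` cone drop ⇒ `(iv-chart)` ⇒ chart pre-datum ⇒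
pre-datum ⇒ datum). The composition below is therefore two lines, and the ONE remaining `sorry` is
the transfer stub `stub_staticPreDatum : ∀ p prime, Nonempty (StaticPreDatum p)` — the
characteristic-`p` construction in static clothing (ONE well-order `Γ`; a usc, smooth-functorial,
base-change-invariant rating of all pairs with `(ii)`; a canonical regular weighted centre on its
maximum locus; restriction monotonicity `(R)`; and NO Φ-RAY `(CI)`: on the punctured weighted normal
cone of its own centre, with the initial ideal of `X`, the rating is everywhere below `max_Y`).

STUBS (registered): `stub_staticPreDatum` (TRANSFER, lead). Wave 1 (static levers) landed; wave 2: none — one stub left.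
-/

noncomputable section

open CategoryTheory AlgebraicGeometry TopologicalSpace
open Literature.AlgebraicGeometry.Resolution
open Summit.ResolutionOfSingularities.ResolutionOfSingularities.Theses.WeightedInvariant

set_option linter.dupNamespace false -- mandated namespace of this single-conjunct summit

namespace Summit.ResolutionOfSingularities.ResolutionOfSingularities.Theorems

/-! ## Static levers (LANDED, Theorems/…StaticLevers.lean and its three stub files)

`stub_inv_mono_of_specializes` (L3), `stub_vertexPrimes` (p128229), `stub_fullBlowup_offExceptional`
(p128133), `stub_fullBlowup_regime` (p128148) and the assembled lever
`StaticPreDatum.inv_le_inv_exceptional_vertex` (L5, p128752: the weighted tangent-cone pair at its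
vertex dominates the pair, for ANY Rees chart) are imported below; they constrain every inhabitant of
the transfer stub (memo `Cruxes/WeightedConstruction/STATIC-LEVERS.md`). -/

-- sanity: the landed levers are available to whoever attacks the transfer
example {p : ℕ} (S : StaticPreDatum p) := @StaticPreDatum.inv_le_inv_exceptional_vertex p S

/-! ## The transfer stub (lead) -/

/-- STUB `stub_staticPreDatum` (TRANSFER, lead): for every prime `p` there is a static pre-datum in
characteristic `p` — ONE well-order `Γ`, a usc smooth-functorial rating of all pairs with `(ii)`, a
regular weighted centre on its maximum locus, RESTRICTION `(R)` and the cone drop `(CI)`. This is the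
characteristic-`p` construction in static form (Abramovich–Temkin–Włodarczyk 2024 §1.9; Włodarczyk
arXiv:2203.03090 Thm. 4.3.1 supplies it in characteristic 0). -/
theorem stub_staticPreDatum : ∀ p : ℕ, p.Prime → Nonempty (StaticPreDatum p) := by
  sorry

/-! ## Composition (sorry-free): static pre-datum ⇒ datum ⇒ crux -/

/-- **The line closes the crux modulo its stubs**: a static pre-datum for every prime gives the weighted
construction (static pre-datum ⇒ chart pre-datum ⇒ pre-datum ⇒ datum, all landed as
`stub_staticReduction`). -/
theorem WeightedConstruction_of
    (hS : ∀ p : ℕ, p.Prime → Nonempty (StaticPreDatum p)) : WeightedConstruction := by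
  intro p hp
  exact stub_staticReduction p (hS p hp)

/-- The crux, from the transfer stub. -/
theorem WeightedConstruction_holds_of_stubs : WeightedConstruction :=
  WeightedConstruction_of stub_staticPreDatum

end Summit.ResolutionOfSingularities.ResolutionOfSingularities.Theorems

end
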